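import Mathlib
import HarnessLib

/-!
# Pontryagin duals and ranks: exactness, isogenies, and the kernel/cokernel of a scalar

Topic `Algebra/Module`; namespace `Literature.Algebra.Module`; THEOREMS ONLY (no definition, no
named fact, no `sorry`).

Mathlib's `CharacterModule S = Hom(S, ℚ/ℤ)` with `(r·φ)(s) = φ(r·s)` is the untopologised
Pontryagin dual of the tree (`CharacterModuleExact.lean`, `Greenberg2016.IsDualPairing`). For a
commutative ring `R`, `T ∈ R` and `R' = R/(T)`, this file supplies the rank bookkeeping used when a
corank computation over `R` is reduced to one over `R'` (R. Greenberg, *On the structure of certain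
Galois cohomology groups* (2006), §2 A p. 348: "The Pontryagin dual of `X/PX` is `A[P]` … The kernel
and cokernel of `ψ` are dual, respectively, to the cokernel and kernel of `φ` … `R`-isogenous …
`ker(ψ)` and `coker(ψ)` are both `R`-cotorsion"; §4 A p. 368 L27–29: "`D/D_{Λ-div}` is
`Λ`-cotorsion … we can assume … that `D` is `Λ`-divisible"):

* `CharacterModule.exact_dual` — `(·)^∨` is exact in the middle;
* `finrank_eq_of_exact_of_smul_eq_zero` — an `R`-ISOGENY statement: in an exact `P → M → M' → Q`
  with `P`, `Q` killed by a non-zero scalar of the domain `R`, `rank_R M = rank_R M'`;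
* `finrank_torsionBy_eq_add_of_exact` — if `X₁ →(T·) X₁ →f Z →g X₂ →(T·) X₂` is exact at
  `X₁, Z, X₂` (second, middle, first spot) and `T Z = 0`, then
  `rank_{R'} Z = rank_{R'} (X₁/TX₁) + rank_{R'} (X₂[T])` (`Z` read as the `R'`-module `Z[T] = Z`);
  `finrank_torsionBy_eq_of_surjective` — the case `g = 0`;
* `exists_range_pow_smul_succ_eq` — for a module `D` with finitely generated dual over a
  Noetherian `R`: `T^{k+1} D = T^k D` for some `k` (so `T^k D` is `T`-divisible and `D/T^k D` is
  killed by `T^k`), the `T`-adic form of "replace `D` by its maximal divisible submodule".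

## References
* R. Greenberg, *On the structure of certain Galois cohomology groups*, Doc. Math. Extra Vol.
  Coates (2006) 335–391, §2 A (pp. 347–348), §4 A (p. 368 L27–29). [Greenberg2006]
-/

namespace Literature.Algebra.Module

open _root_.Module Submodule Function

universe u v w

/-! ## §1. Exactness of Pontryagin duality -/

section Dual

variable {R : Type u} [CommRing R] {A : Type v} {B : Type v} {C : Type v}
  [AddCommGroup A] [Module R A] [AddCommGroup B] [Module R B] [AddCommGroup C] [Module R C]

/-- **Pontryagin duality is exact**: if `A →f B →g C` is exact at `B`, then
`C^∨ →g^∨ B^∨ →f^∨ A^∨` is exact at `B^∨` (a character of `B` vanishing on `f(A) = ker g` descends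
to `B/ker g ↪ C` and extends to `C` by the injectivity of `ℚ/ℤ`, Mathlib
`CharacterModule.dual_surjective_of_injective`). [cite: Greenberg2006, §2 A (p. 348 L4–6: "The kernel and cokernel of `ψ` are dual, respectively, to the cokernel and kernel of `φ`")] -/
theorem CharacterModule.exact_dual {f : A →ₗ[R] B} {g : B →ₗ[R] C} (hfg : Exact f g) :
    Exact (CharacterModule.dual g) (CharacterModule.dual f) := by
  intro φ
  constructor
  · intro hφ
    -- `φ` kills `range f = ker g`
    have hφker : (LinearMap.ker g).toAddSubgroup ≤ (φ : B →+ AddCircle (1 : ℚ)).ker := by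
      intro b hb
      obtain ⟨a, rfl⟩ := (hfg b).mp hb
      exact DFunLike.congr_fun hφ a
    let φbar : CharacterModule (B ⧸ LinearMap.ker g) :=
      QuotientAddGroup.lift (LinearMap.ker g).toAddSubgroup φ hφker
    let gbar : (B ⧸ LinearMap.ker g) →ₗ[R] C := (LinearMap.ker g).liftQ g le_rfl
    have hgbar : Injective gbar := by
      rw [← LinearMap.ker_eq_bot]
      exact Submodule.ker_liftQ_eq_bot _ _ _ le_rfl
    obtain ⟨ψ, hψ⟩ := CharacterModule.dual_surjective_of_injective gbar hgbar φbar
    refine ⟨ψ, ?_⟩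
    ext b
    have : φbar (Submodule.Quotient.mk b) = φ b := rfl
    rw [← this, ← hψ]
    rfl
  · rintro ⟨ψ, rfl⟩
    ext a
    change ψ (g (f a)) = 0
    rw [hfg.apply_apply_eq_zero, map_zero]

/-- The dual of multiplication by a scalar is multiplication by that scalar. [cite: Greenberg2006, §2 A (p. 348 L1–3: "The Pontryagin dual of `X/PX` is `A[P]`")] -/
theorem CharacterModule.dual_smul_id (T : R) :
    CharacterModule.dual (T • (LinearMap.id : A →ₗ[R] A)) = T • LinearMap.id := by
  ext φ a; rfl

end Dual

/-! ## §2. Isogenies: ranks along exact sequences with torsion ends -/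

section Isogeny

variable {R : Type u} [CommRing R] [IsDomain R]
  {P : Type v} {M : Type v} {M' : Type v} {Q : Type v}
  [AddCommGroup P] [Module R P] [AddCommGroup M] [Module R M] [AddCommGroup M'] [Module R M']
  [AddCommGroup Q] [Module R Q]

/-- Rank–nullity over a domain: `rank M = rank (ker φ) + rank (im φ)`. [folklore] -/
private theorem finrank_eq_ker_add_range [Module.Finite R M] (φ : M →ₗ[R] M') :
    finrank R M = finrank R (LinearMap.ker φ) + finrank R (LinearMap.range φ) := by
  rw [← φ.quotKerEquivRange.finrank_eq, add_comm, Submodule.finrank_quotient_add_finrank]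

omit [IsDomain R] in
/-- A module killed by a non-zero scalar has rank `0`. [folklore] -/
private theorem finrank_eq_zero_of_smul_eq_zero' {N : Type v} [AddCommGroup N] [Module R N] {u : R}
    (hu : u ≠ 0) (h : ∀ x : N, u • x = 0) : finrank R N = 0 :=
  finrank_eq_zero_of_rank_eq_zero (rank_eq_zero_iff.mpr fun x ↦ ⟨u, hu, h x⟩)

/-- **`R`-isogenies preserve the rank**: if `P →a M →b M' →c Q` is exact at `M` and at `M'` and the
outer terms are killed by a non-zero scalar `u` of the domain `R` (so are `R`-torsion), then
`rank_R M = rank_R M'`. [cite: Greenberg2006, §2 A (p. 348 L6–9: "`R`-isogenous if … `ker(ψ)` and `coker(ψ)` are both `R`-cotorsion")] -/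
theorem finrank_eq_of_exact_of_smul_eq_zero [Module.Finite R M] [Module.Finite R M']
    (a : P →ₗ[R] M) (b : M →ₗ[R] M') (c : M' →ₗ[R] Q) (hab : Exact a b) (hbc : Exact b c)
    {u : R} (hu : u ≠ 0) (hP : ∀ x : P, u • x = 0) (hQ : ∀ x : Q, u • x = 0) :
    finrank R M = finrank R M' := by
  have h1 := finrank_eq_ker_add_range b
  have h2 := finrank_eq_ker_add_range c
  have hker : finrank R (LinearMap.ker b) = 0 := by
    rw [LinearMap.exact_iff.mp hab]
    refine finrank_eq_zero_of_smul_eq_zero' hu fun x ↦ ?_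
    obtain ⟨x, hx⟩ := x
    obtain ⟨y, rfl⟩ := hx
    exact Subtype.ext (by simp [← map_smul, hP y])
  have hrange : finrank R (LinearMap.range c) = 0 := by
    refine finrank_eq_zero_of_smul_eq_zero' hu fun x ↦ Subtype.ext ?_
    simpa using hQ x
  rw [LinearMap.exact_iff.mp hbc] at h2
  omega

end Isogeny

/-! ## §3. `rank_{R/(T)}` of a module killed by `T` from the kernel and cokernel of `T` -/

section ModT

variable {R : Type u} [CommRing R] (T : R)
  {X₁ : Type v} {Z : Type v} {X₂ : Type v}
  [AddCommGroup X₁] [Module R X₁] [AddCommGroup Z] [Module R Z] [AddCommGroup X₂] [Module R X₂]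

/-- **Rank bookkeeping modulo `T`.** Let `R' = R/(T)` be a domain. Suppose
`X₁ →(T·) X₁ →f Z →g X₂ →(T·) X₂` is exact at the inner three spots (`ker f = T X₁`, `ker g = im f`,
`im g = X₂[T]`) and `T Z = 0`. Then, reading `Z = Z[T]` as an `R'`-module,
`rank_{R'} Z = rank_{R'} (X₁/TX₁) + rank_{R'} (X₂[T])` — `Z` is an extension of `X₂[T]` by
`X₁/TX₁`. (Dual form of "the kernel and cokernel of `ψ` are dual to the cokernel and kernel of
`φ`" applied to multiplication by `T`.) [cite: Greenberg2006, §2 A (p. 348 L1–6)] -/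
theorem finrank_torsionBy_eq_add_of_exact [IsDomain (R ⧸ Ideal.span {T})] [Module.Finite R Z]
    (f : X₁ →ₗ[R] Z) (g : Z →ₗ[R] X₂) (hZ : ∀ z : Z, T • z = 0)
    (h₁ : Exact (T • (LinearMap.id : X₁ →ₗ[R] X₁)) f) (h₂ : Exact f g)
    (h₃ : Exact g (T • (LinearMap.id : X₂ →ₗ[R] X₂))) :
    finrank (R ⧸ Ideal.span {T}) (torsionBy R Z T) =
      finrank (R ⧸ Ideal.span {T}) (X₁ ⧸ (Ideal.span {T} • ⊤ : Submodule R X₁)) +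
        finrank (R ⧸ Ideal.span {T}) (torsionBy R X₂ T) := by
  have hs : Surjective (algebraMap R (R ⧸ Ideal.span {T})) := Ideal.Quotient.mk_surjective
  haveI : Module.Finite R (torsionBy R Z T) :=
    Module.Finite.of_surjective (LinearMap.codRestrict _ LinearMap.id fun z ↦
      (mem_torsionBy_iff T _).mpr (hZ z)) fun z ↦ ⟨z, rfl⟩
  haveI : Module.Finite (R ⧸ Ideal.span {T}) (torsionBy R Z T) :=
    Module.Finite.of_restrictScalars_finite R _ _
  -- `f` descends to `X₁/TX₁ → Z[T]`, injective
  have hle : (Ideal.span {T} • ⊤ : Submodule R X₁) ≤ LinearMap.ker f := by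
    rw [Submodule.ideal_span_singleton_smul]
    intro x hx
    obtain ⟨y, -, rfl⟩ := (Submodule.mem_smul_pointwise_iff_exists _ _ _).mp hx
    exact (h₁ (T • y)).mpr ⟨y, by simp⟩
  have hfZ : ∀ x : X₁, f x ∈ torsionBy R Z T := fun x ↦ (mem_torsionBy_iff T _).mpr (hZ _)
  let f₁ : (X₁ ⧸ (Ideal.span {T} • ⊤ : Submodule R X₁)) →ₗ[R] torsionBy R Z T :=
    (Ideal.span {T} • ⊤ : Submodule R X₁).liftQ (LinearMap.codRestrict _ f hfZ) (by
      intro x hx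
      rw [LinearMap.mem_ker]
      exact Subtype.ext (hle hx))
  have hf₁ : Injective f₁ := by
    rw [← LinearMap.ker_eq_bot, eq_bot_iff]
    intro q hq
    obtain ⟨x, rfl⟩ := Submodule.mkQ_surjective _ q
    have hx : f x = 0 := congrArg Subtype.val hq
    obtain ⟨y, hy⟩ := (h₁ x).mp hx
    rw [Submodule.mem_bot, Submodule.mkQ_apply, Submodule.Quotient.mk_eq_zero, ← hy,
      Submodule.ideal_span_singleton_smul]
    exact Submodule.smul_mem_pointwise_smul _ _ _ Submodule.mem_top
  -- `g` restricts to `Z[T] → X₂[T]`, surjective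
  have hgX : ∀ z ∈ torsionBy R Z T, g z ∈ torsionBy R X₂ T := fun z _ ↦
    (mem_torsionBy_iff T _).mpr (by rw [← map_smul, hZ, map_zero])
  let g₁ : torsionBy R Z T →ₗ[R] torsionBy R X₂ T := g.restrict hgX
  have hg₁ : Surjective g₁ := by
    intro x
    obtain ⟨z, hz⟩ := (h₃ (x : X₂)).mp (by
      simpa only [LinearMap.smul_apply, LinearMap.id_coe, id_eq] using
        (mem_torsionBy_iff T (x : X₂)).mp x.2)
    exact ⟨⟨z, (mem_torsionBy_iff T z).mpr (hZ z)⟩, Subtype.ext hz⟩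
  have hex : Exact f₁ g₁ := by
    intro z
    constructor
    · intro hz
      obtain ⟨x, hx⟩ := (h₂ (z : Z)).mp (congrArg Subtype.val hz)
      exact ⟨Submodule.Quotient.mk x, Subtype.ext hx⟩
    · rintro ⟨q, rfl⟩
      obtain ⟨x, rfl⟩ := Submodule.mkQ_surjective _ q
      exact Subtype.ext (h₂.apply_apply_eq_zero x)
  -- count over `R'`
  have e1 : finrank (R ⧸ Ideal.span {T}) (torsionBy R Z T) =
      finrank (R ⧸ Ideal.span {T}) (LinearMap.ker (g₁.extendScalarsOfSurjective hs)) +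
        finrank (R ⧸ Ideal.span {T}) (LinearMap.range (g₁.extendScalarsOfSurjective hs)) := by
    rw [← (g₁.extendScalarsOfSurjective hs).quotKerEquivRange.finrank_eq, add_comm,
      Submodule.finrank_quotient_add_finrank]
  have e2 : LinearMap.ker (g₁.extendScalarsOfSurjective hs) =
      LinearMap.range (f₁.extendScalarsOfSurjective hs) := LinearMap.exact_iff.mp hex
  have e3 : LinearMap.range (g₁.extendScalarsOfSurjective hs) = ⊤ := LinearMap.range_eq_top.mpr hg₁
  rw [e1, e2, e3, finrank_top,
    ← (LinearEquiv.ofInjective (f₁.extendScalarsOfSurjective hs) hf₁).finrank_eq]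

/-- The case `g = 0` of `finrank_torsionBy_eq_add_of_exact`: if `X₁ →(T·) X₁ →f Z → 0` is exact
(`f` surjective with kernel `T X₁`) and `T Z = 0`, then `rank_{R'} Z = rank_{R'} (X₁/TX₁)`.
[cite: Greenberg2006, §2 A (p. 348 L1–3: "The Pontryagin dual of `X/PX` is `A[P]`")] -/
theorem finrank_torsionBy_eq_of_surjective [IsDomain (R ⧸ Ideal.span {T})] [Module.Finite R Z]
    (f : X₁ →ₗ[R] Z) (hZ : ∀ z : Z, T • z = 0)
    (h₁ : Exact (T • (LinearMap.id : X₁ →ₗ[R] X₁)) f) (hf : Surjective f) :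
    finrank (R ⧸ Ideal.span {T}) (torsionBy R Z T) =
      finrank (R ⧸ Ideal.span {T}) (X₁ ⧸ (Ideal.span {T} • ⊤ : Submodule R X₁)) := by
  have h₂ : Exact f (0 : Z →ₗ[R] PUnit.{v + 1}) := by
    intro z
    simp only [LinearMap.zero_apply, true_iff]
    exact hf z
  have h₃ : Exact (0 : Z →ₗ[R] PUnit.{v + 1})
      (T • (LinearMap.id : PUnit.{v + 1} →ₗ[R] PUnit.{v + 1})) := by
    intro x
    constructor
    · intro _; exact ⟨0, Subsingleton.elim _ _⟩
    · intro _; exact Subsingleton.elim _ _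
  have := finrank_torsionBy_eq_add_of_exact T f 0 hZ h₁ h₂ h₃
  rwa [finrank_zero_of_subsingleton (M := torsionBy R PUnit.{v + 1} T), add_zero] at this

end ModT

/-! ## §4. `T^k D` is `T`-divisible for `k ≫ 0` -/

section Stabilise

variable {R : Type u} [CommRing R] [IsNoetherianRing R] {D : Type v} [AddCommGroup D] [Module R D]

/-- **`T^{k+1} D = T^k D` for some `k`, when the Pontryagin dual of `D` is finitely generated over
the Noetherian ring `R`**: the chain `D^∨[T^k]` of annihilators of the `T^k D` is stationary and
characters separate the points of `D/T^{k+1}D`. Then `D' = T^k D` is `T`-divisible and `D/D'` is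
killed by `T^k` — the `T`-adic form of "`D/D_{Λ-div}` is `Λ`-cotorsion … we can assume … that `D`
is `Λ`-divisible". [cite: Greenberg2006, §4 A (p. 368 L27–29)] -/
theorem exists_range_pow_smul_succ_eq [Module.Finite R (CharacterModule D)] (T : R) :
    ∃ k : ℕ, LinearMap.range (T ^ (k + 1) • (LinearMap.id : D →ₗ[R] D)) =
      LinearMap.range (T ^ k • (LinearMap.id : D →ₗ[R] D)) := by
  -- the ascending chain of annihilators
  let N : ℕ →o Submodule R (CharacterModule D) :=
    ⟨fun k ↦ torsionBy R (CharacterModule D) (T ^ k), fun k l hkl φ hφ ↦ by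
      rw [mem_torsionBy_iff] at hφ ⊢
      obtain ⟨m, rfl⟩ := Nat.exists_eq_add_of_le hkl
      rw [pow_add, mul_comm, mul_smul, hφ, smul_zero]⟩
  obtain ⟨k, hk⟩ := monotone_stabilizes_iff_noetherian.mpr (inferInstance) N
  refine ⟨k, le_antisymm ?_ ?_⟩
  · rintro _ ⟨x, rfl⟩
    refine ⟨T • x, ?_⟩
    change T ^ k • (T • x) = T ^ (k + 1) • x
    rw [smul_smul, ← pow_succ]
  · rintro _ ⟨x, rfl⟩
    by_contra hx
    set M : Submodule R D := LinearMap.range (T ^ (k + 1) • (LinearMap.id : D →ₗ[R] D)) with hM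
    have hne : Submodule.Quotient.mk (p := M) ((T ^ k • (LinearMap.id : D →ₗ[R] D)) x) ≠ 0 := by
      rwa [Ne, Submodule.Quotient.mk_eq_zero]
    obtain ⟨χ, hχ⟩ := CharacterModule.exists_character_apply_ne_zero_of_ne_zero hne
    -- pull `χ` back to `D`: it is killed by `T^{k+1}`, hence by `T^k`
    let χ' : CharacterModule D := χ.comp (M.mkQ : D →ₗ[R] D ⧸ M).toAddMonoidHom
    have h1 : χ' ∈ N (k + 1) := by
      rw [show N (k + 1) = torsionBy R (CharacterModule D) (T ^ (k + 1)) from rfl, mem_torsionBy_iff]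
      ext d
      change χ (M.mkQ ((T ^ (k + 1)) • d)) = 0
      have : M.mkQ ((T ^ (k + 1)) • d) = 0 :=
        (Submodule.Quotient.mk_eq_zero M).mpr ⟨d, by simp⟩
      rw [this, map_zero]
    rw [← hk (k + 1) (Nat.le_succ k)] at h1
    have h2 : (T ^ k • χ') x = 0 := by
      rw [(mem_torsionBy_iff _ _).mp h1]; rfl
    exact hχ h2

/-- Reading `exists_range_pow_smul_succ_eq`: with `D' = T^k D`, every element of `D'` is `T`
times an element of `D'`. [cite: Greenberg2006, §4 A (p. 368 L27–29)] -/
theorem exists_pow_smul_divisible [Module.Finite R (CharacterModule D)] (T : R) :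
    ∃ k : ℕ, ∀ y ∈ LinearMap.range (T ^ k • (LinearMap.id : D →ₗ[R] D)),
      ∃ z ∈ LinearMap.range (T ^ k • (LinearMap.id : D →ₗ[R] D)), T • z = y := by
  obtain ⟨k, hk⟩ := exists_range_pow_smul_succ_eq (D := D) T
  refine ⟨k, fun y hy ↦ ?_⟩
  rw [← hk] at hy
  obtain ⟨x, rfl⟩ := hy
  refine ⟨(T ^ k • (LinearMap.id : D →ₗ[R] D)) x, ⟨x, rfl⟩, ?_⟩
  change T • (T ^ k • x) = T ^ (k + 1) • x
  rw [smul_smul, ← pow_succ']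

end Stabilise

end Literature.Algebra.Module
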